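import Literature.Barriers.CriticalPhenomena.PositionSpaceRGNonGibbsianPinnedTorus
import Literature.Probability.LatticeModels.IsingPeierlsFlip
import Literature.Probability.LatticeModels.IsingEffectiveField
import HarnessLib

/-!
# The Peierls condition on the torus and the dissemination bound for bad cells

Support file for the Theorem 4.3 line of the barrier
`Literature/Barriers/CriticalPhenomena/PositionSpaceRGNonGibbsian.lean` (van Enter–Fernández–Sokal
1993, Theorem 4.3: the `+` phase of the internal spins with alternating frozen image spins, `b ≥ 3`;
the source obtains it from Pirogov–Sinai theory, §4.3.2 / App. B.5.3, whose model-specific input is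
the Peierls condition of App. B.5.3; this line of files uses that Peierls condition inside a
reflection-positivity / chessboard argument instead). Here the zero-temperature Peierls condition of
App. B.5.3 — proved on `ℤ^d` in `…PeierlsCondition.lean` (`sum_imgField_ge`: the field energy
released by a region of `-` internal spins is at most half the number of internal bonds it breaks) —
is transferred to the torus `(ℤ/Nbℤ)^d`, and the "universal contour" of the chessboard estimate is
bounded:

* `tField`, `ffPairsT`: the field of the frozen image spins at an internal site of the torus and the
  internal boundary pairs of a set of internal sites; **`sum_tField_ge`**: `-∑_{u ∈ M} h_u ≤ #∂M/2`
  on the torus. Proof: lift `M` to `K` periods in each direction (`liftSet`); the fields add up to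
  exactly `K^d` times the torus sum (`sum_imgField_liftSet`), the boundary pairs of the lift are at
  most `K^d` times those of `M` plus `2d(KL)^{d-1}` pairs leaving the box (`card_ffBdryPairs_liftSet_le`),
  apply `sum_imgField_ge` (the lifted frozen pattern has isolated `-` spins,
  `minusIsolated_liftPin`) and let `K → ∞`.
* **`isingHamiltonian_sub_tPlus`**: on the torus, `H(σ) - H(ω⁺) = 2F(σ) + 2∑_{σ_u = -1} h_u` with
  `F(σ)` the number of frustrated internal bonds (van Enter–Fernández–Sokal (B.71)), hence
  **`frustPairs_le_energy`**: `H(σ) - H(ω⁺) ≥ F(σ)`.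
* **`card_frustPairs_ge_of_forall_badCell`**: if every cell is bad then `F(σ) ≥ (N/2)^d` (each of
  the `(N/2)^d` pairwise disjoint even cells contains a frustrated internal bond, because the
  internal sites of a closed cell are connected by internal bonds, `exists_adj_ne_of_badCell`).
* **`tExpect_prodBad_univ_le`** (the dissemination bound): for `β ≥ 0`, `N` even, `b ≥ 2`, `d ≥ 2`,
  `⟨∏_{all cells} bad⟩ ≤ (2^{b^d} e^{-β/2^d})^{N^d}` (`2^{#internal sites}` configurations, each of
  Boltzmann weight at most `e^{-β(N/2)^d}` times that of `ω⁺`).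

No named facts are introduced (D-0014, D-0026).

## References

* A. C. D. van Enter, R. Fernández, A. D. Sokal, J. Stat. Phys. 72 (1993) 879–1167, §4.3.2 and
  App. B.5.3, eqs. (B.71)–(B.77) [VanenterFernandezSokal1993].
* S. Friedli, Y. Velenik, *Statistical Mechanics of Lattice Systems*, CUP 2017, Theorem 10.11 and
  §10.4.2 (the universal contour), Lemma 3.36 [FriedliVelenik2017].
-/

noncomputable section

namespace Literature.Barriers.CriticalPhenomena.NonGibbs

open Finset Relation Literature.Probability.LatticeModels

variable {d : ℕ}

/-! ### The projection `ℤ^d → (ℤ/Lℤ)^d`: neighbours, fibres and faces of a box of periods -/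

section Proj

variable {L : ℕ}

/-- A downward unit step projects to a downward unit step. [folklore] -/
theorem proj_sub_single (L : ℕ) (y : Site d) (i : Fin d) :
    Torus.proj L y - Pi.single i 1 = Torus.proj L (y - Pi.single i 1) := by
  funext j
  by_cases hj : j = i
  · subst hj; simp [Torus.proj]
  · simp [Torus.proj, hj]

/-- Two points of `ℤ^d` with the same projection and all coordinates closer than `L` coincide.
[folklore] -/
theorem eq_of_proj_eq_of_abs_lt {y y' : Site d} (h : Torus.proj L y = Torus.proj L y')
    (habs : ∀ i, |y i - y' i| < L) : y = y' := by
  funext i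
  have hi := congrFun h i
  simp only [Torus.proj] at hi
  rw [ZMod.intCast_eq_intCast_iff_dvd_sub] at hi
  have h0 : y' i - y i = 0 := Int.eq_zero_of_abs_lt_dvd hi (by rw [abs_sub_comm]; exact habs i)
  linarith

/-- A coordinate of a `ℤ^d`-neighbour differs by at most one. [folklore] -/
theorem abs_sub_le_one_of_zdGraph_adj {y a : Site d} (h : (zdGraph d).Adj y a) (k : Fin d) : |a k - y k| ≤ 1 := by
  obtain ⟨i, h | h⟩ := (zdGraph_adj_iff y a).1 h
  · rw [h]; by_cases hk : k = i
    · subst hk; simp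
    · simp [hk]
  · rw [h]; by_cases hk : k = i
    · subst hk; simp
    · simp [hk]

/-- For `L ≥ 3` the projection is injective on the neighbours of a point. [folklore] -/
theorem eq_of_adj_of_adj_of_proj_eq (hL : 3 ≤ L) {y a a' : Site d} (ha : (zdGraph d).Adj y a)
    (ha' : (zdGraph d).Adj y a') (h : Torus.proj L a = Torus.proj L a') : a = a' := by
  refine eq_of_proj_eq_of_abs_lt h fun i => ?_
  have h1 := abs_sub_le_one_of_zdGraph_adj ha i
  have h2 := abs_sub_le_one_of_zdGraph_adj ha' i
  have : |a i - a' i| ≤ 2 := by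
    rw [show a i - a' i = (a i - y i) - (a' i - y i) by ring]
    exact (abs_sub _ _).trans (by linarith)
  have hL' : (3 : ℤ) ≤ L := by exact_mod_cast hL
  linarith

/-- For `L ≥ 2` the projection of a unit step is adjacent to the projection. [folklore] -/
theorem torusGraph_adj_proj_of_adj (hL : 2 ≤ L) {y a : Site d} (ha : (zdGraph d).Adj y a) :
    (torusGraph d L).Adj (Torus.proj L y) (Torus.proj L a) := by
  rw [torusGraph_adj_iff]
  have hne : Torus.proj L y ≠ Torus.proj L a := by
    intro h
    have := eq_of_proj_eq_of_abs_lt h fun i => by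
      have h1 := abs_sub_le_one_of_zdGraph_adj ha i
      rw [abs_sub_comm] at h1
      have hL' : (2 : ℤ) ≤ L := by exact_mod_cast hL
      linarith
    exact ha.ne this
  refine ⟨hne, ?_⟩
  obtain ⟨i, h | h⟩ := (zdGraph_adj_iff y a).1 ha
  · exact Or.inl ⟨i, by rw [h, proj_add_single]⟩
  · exact Or.inr ⟨i, by rw [h, proj_add_single]⟩

/-- For `L ≥ 2` the torus neighbours of a projected point are the projections of the
`ℤ^d`-neighbours. [folklore] -/
theorem torusGraph_adj_proj_iff (hL : 2 ≤ L) {y : Site d} {x' : TorusSite d L} :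
    (torusGraph d L).Adj (Torus.proj L y) x' ↔ ∃ a, (zdGraph d).Adj y a ∧ Torus.proj L a = x' := by
  constructor
  · intro h
    obtain ⟨-, ⟨i, hi⟩ | ⟨i, hi⟩⟩ := (torusGraph_adj_iff _ _).1 h
    · exact ⟨y + Pi.single i 1, (zdGraph_adj_iff _ _).2 ⟨i, Or.inl rfl⟩, by rw [hi, proj_add_single]⟩
    · refine ⟨y - Pi.single i 1, (zdGraph_adj_iff _ _).2 ⟨i, Or.inr (by rw [sub_add_cancel])⟩, ?_⟩
      rw [← proj_sub_single, hi, add_sub_cancel_right]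
  · rintro ⟨a, ha, rfl⟩
    exact torusGraph_adj_proj_of_adj hL ha

variable (d) in
/-- The box of `K` periods `[0, KL)^d ⊂ ℤ^d`. [folklore] -/
def periodBox (K L : ℕ) : Finset (Site d) := Fintype.piFinset fun _ => Finset.Ico (0 : ℤ) ((K * L : ℕ) : ℤ)

/-- Membership in the box of periods. [folklore] -/
theorem mem_periodBox {K L : ℕ} {y : Site d} : y ∈ periodBox d K L ↔ ∀ i, 0 ≤ y i ∧ y i < ((K * L : ℕ) : ℤ) := by
  simp [periodBox, Fintype.mem_piFinset]

/-- The box of periods has `(KL)^d` points. [folklore] -/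
theorem card_periodBox (K L : ℕ) : #(periodBox d K L) = (K * L) ^ d := by
  rw [periodBox, Fintype.card_piFinset_const, Int.card_Ico]
  simp only [sub_zero, Int.toNat_natCast]

/-- **The fibres of the projection restricted to a box of periods have `K^d` points.** [folklore] -/
theorem card_filter_periodBox_proj_eq [NeZero L] (K : ℕ) (x : TorusSite d L) :
    #((periodBox d K L).filter fun y => Torus.proj L y = x) = K ^ d := by
  classical
  -- the fibre is a product of one-dimensional fibres, each an arithmetic progression of length `K`
  have h1d : ∀ (r : ZMod L), #((Finset.Ico (0 : ℤ) ((K * L : ℕ) : ℤ)).filter fun v : ℤ => (v : ZMod L) = r) = K := by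
    intro r
    have hL0 : (0 : ℤ) < L := by exact_mod_cast Nat.pos_of_ne_zero (NeZero.ne L)
    have hset : ((Finset.Ico (0 : ℤ) ((K * L : ℕ) : ℤ)).filter fun v : ℤ => (v : ZMod L) = r) =
        (Finset.range K).image fun q : ℕ => (r.val : ℤ) + L * q := by
      ext v
      simp only [mem_filter, Finset.mem_Ico, mem_image, Finset.mem_range]
      constructor
      · rintro ⟨⟨hv0, hvK⟩, hvr⟩
        have hvr' : (v : ZMod L) = ((r.val : ℤ) : ZMod L) := by rw [hvr]; simp
        rw [ZMod.intCast_eq_intCast_iff_dvd_sub] at hvr'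
        obtain ⟨c, hc⟩ := hvr'
        have hrv : ((r.val : ℤ)) < L := by exact_mod_cast ZMod.val_lt r
        have hr0 : (0 : ℤ) ≤ r.val := by positivity
        have hc0 : 0 ≤ -c := by nlinarith
        have hcK : -c < K := by
          push_cast at hvK
          nlinarith
        refine ⟨(-c).toNat, ?_, ?_⟩
        · omega
        · rw [Int.toNat_of_nonneg hc0]; linarith
      · rintro ⟨q, hq, rfl⟩
        have hrv : ((r.val : ℤ)) < L := by exact_mod_cast ZMod.val_lt r
        have hr0 : (0 : ℤ) ≤ r.val := by positivity
        refine ⟨⟨by positivity, ?_⟩, by push_cast; simp⟩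
        push_cast
        have : (q : ℤ) + 1 ≤ K := by exact_mod_cast hq
        nlinarith
    rw [hset, card_image_of_injective _ fun q q' h => by
      have hL0' : (L : ℤ) ≠ 0 := hL0.ne'
      have := mul_left_cancel₀ hL0' (add_left_cancel h)
      exact_mod_cast this]
    exact Finset.card_range K
  have hset : ((periodBox d K L).filter fun y => Torus.proj L y = x) =
      Fintype.piFinset fun i => (Finset.Ico (0 : ℤ) ((K * L : ℕ) : ℤ)).filter fun v : ℤ => (v : ZMod L) = x i := by
    ext y
    simp only [mem_filter, mem_periodBox, Fintype.mem_piFinset, Finset.mem_Ico, funext_iff, Torus.proj]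
    exact ⟨fun h i => ⟨h.1 i, h.2 i⟩, fun h => ⟨fun i => (h i).1, fun i => (h i).2⟩⟩
  rw [hset, Fintype.card_piFinset, Finset.prod_congr rfl fun i _ => h1d (x i), Finset.prod_const, card_univ,
    Fintype.card_fin]

/-- **Sums over a box of periods of a function of the projection**: `K^d` times the sum over the torus.
[folklore] -/
theorem sum_filter_periodBox_comp_proj [NeZero L] (K : ℕ) (M : Finset (TorusSite d L)) (f : TorusSite d L → ℝ) :
    ∑ y ∈ (periodBox d K L).filter (fun y => Torus.proj L y ∈ M), f (Torus.proj L y) = (K : ℝ) ^ d * ∑ x ∈ M, f x := by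
  classical
  rw [Finset.mul_sum]
  have : ∀ x ∈ M, (K : ℝ) ^ d * f x = ∑ y ∈ (periodBox d K L).filter (fun y => Torus.proj L y = x), f (Torus.proj L y) := by
    intro x _
    rw [Finset.sum_congr rfl fun y hy => by rw [(mem_filter.1 hy).2], Finset.sum_const, card_filter_periodBox_proj_eq,
      nsmul_eq_mul]
    push_cast; ring
  rw [Finset.sum_congr rfl this, ← Finset.sum_biUnion]
  · congr 1
    ext y
    simp only [mem_filter, mem_biUnion]
    exact ⟨fun ⟨hy, hM⟩ => ⟨_, hM, hy, rfl⟩, fun ⟨x, hx, hy, hyx⟩ => ⟨hy, hyx ▸ hx⟩⟩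
  · intro x _ x' _ hxx'
    rw [Function.onFun, Finset.disjoint_left]
    intro y hy hy'
    exact hxx' ((mem_filter.1 hy).2.symm.trans (mem_filter.1 hy').2)

/-- Sums over a box of periods of an `ℕ`-valued function of the projection. [folklore] -/
theorem sum_filter_periodBox_comp_proj_nat [NeZero L] (K : ℕ) (M : Finset (TorusSite d L)) (f : TorusSite d L → ℕ) :
    ∑ y ∈ (periodBox d K L).filter (fun y => Torus.proj L y ∈ M), f (Torus.proj L y) = K ^ d * ∑ x ∈ M, f x := by
  have h := sum_filter_periodBox_comp_proj K M (fun x => (f x : ℝ))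
  exact_mod_cast h

/-- The cardinality of a filtered product as a sum over the first factor. [folklore] -/
theorem card_filter_product_eq_sum {α γ : Type*} (s : Finset α) (t : Finset γ) (P : α × γ → Prop) [DecidablePred P] :
    #((s ×ˢ t).filter P) = ∑ a ∈ s, #(t.filter fun c => P (a, c)) := by
  classical
  rw [card_filter, sum_product]
  refine sum_congr rfl fun a _ => ?_
  rw [card_filter]

/-- **A face of the box of periods has at most `(KL)^{d-1}` points**: the points of the box with a
prescribed `i`-th coordinate times the `KL` values of that coordinate inject into the box. [folklore] -/
theorem card_filter_periodBox_apply_eq_mul_le (K L : ℕ) (i : Fin d) (v : ℤ) :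
    #((periodBox d K L).filter fun y => y i = v) * (K * L) ≤ (K * L) ^ d := by
  classical
  rw [← card_periodBox K L]
  have hIco : #(Finset.Ico (0 : ℤ) ((K * L : ℕ) : ℤ)) = K * L := by
    rw [Int.card_Ico, sub_zero]; exact_mod_cast Int.toNat_natCast (K * L)
  rw [← hIco, ← Finset.card_product]
  refine Finset.card_le_card_of_injOn (fun q => Function.update q.1 i q.2) (fun q hq => ?_) ?_
  · rw [Finset.mem_coe, Finset.mem_product, mem_filter] at hq
    rw [Finset.mem_coe, mem_periodBox]
    intro j
    show 0 ≤ Function.update q.1 i q.2 j ∧ Function.update q.1 i q.2 j < ((K * L : ℕ) : ℤ)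
    by_cases hj : j = i
    · subst hj; rw [Function.update_self]; exact ⟨(Finset.mem_Ico.1 hq.2).1, (Finset.mem_Ico.1 hq.2).2⟩
    · rw [Function.update_of_ne hj]; exact (mem_periodBox.1 hq.1.1) j
  · rintro ⟨y, s⟩ hq ⟨y', s'⟩ hq' h
    simp only [Finset.mem_coe, Finset.mem_product, mem_filter] at hq hq'
    have hs : s = s' := by
      have := congrFun h i; simpa using this
    subst hs
    simp only [Prod.mk.injEq, and_true]
    funext j
    by_cases hj : j = i
    · subst hj; rw [hq.1.2, hq'.1.2]
    · have := congrFun h j; simpa [Function.update_of_ne hj] using this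

/-- The pairs (point of the box, `ℤ^d`-neighbour outside the box) number at most `2d (KL)^{d-1}`.
[folklore] -/
theorem card_boxExitPairs_le (K L : ℕ) :
    #(((periodBox d K L) ×ˢ ((periodBox d K L).biUnion fun y => (zdGraph d).neighborFinset y)).filter
        fun q => q.2 ∉ periodBox d K L ∧ (zdGraph d).Adj q.1 q.2) ≤ 2 * d * (K * L) ^ (d - 1) := by
  classical
  set B := ((periodBox d K L) ×ˢ ((periodBox d K L).biUnion fun y => (zdGraph d).neighborFinset y)).filter
        fun q => q.2 ∉ periodBox d K L ∧ (zdGraph d).Adj q.1 q.2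
  -- the faces
  set faceUp : Fin d → Finset (Site d) := fun i => (periodBox d K L).filter fun y => y i = (K * L : ℕ) - 1
  set faceDn : Fin d → Finset (Site d) := fun i => (periodBox d K L).filter fun y => y i = 0
  have hface : ∀ (i : Fin d) (v : ℤ), #((periodBox d K L).filter fun y => y i = v) ≤ (K * L) ^ (d - 1) := by
    intro i v
    rcases Nat.eq_zero_or_pos (K * L) with hKL | hKL
    · have hempty : periodBox d K L = ∅ := by
        refine eq_empty_iff_forall_notMem.2 fun y hy => ?_
        have := (mem_periodBox.1 hy) i
        rw [hKL] at this
        push_cast at this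
        omega
      rw [hempty, filter_empty, card_empty]
      exact Nat.zero_le _
    have h := card_filter_periodBox_apply_eq_mul_le (d := d) K L i v
    have hd : (K * L) ^ d = (K * L) ^ (d - 1) * (K * L) := by
      rcases Nat.eq_zero_or_pos d with h0 | hpos
      · subst h0; exact absurd i.isLt (Nat.not_lt_zero _)
      · rw [← pow_succ, Nat.sub_add_cancel hpos]
    rw [hd] at h
    exact Nat.le_of_mul_le_mul_right h hKL
  have hsub : B ⊆ (univ : Finset (Fin d)).biUnion fun i =>
      (faceUp i).image (fun y => (y, y + Pi.single i 1)) ∪ (faceDn i).image (fun y => (y, y - Pi.single i 1)) := by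
    rintro ⟨y, w⟩ hq
    simp only [B, mem_filter, mem_product] at hq
    obtain ⟨⟨hy, -⟩, hw, hadj⟩ := hq
    rw [mem_biUnion]
    obtain ⟨i, h | h⟩ := (zdGraph_adj_iff y w).1 hadj
    · refine ⟨i, mem_univ _, mem_union_left _ (mem_image.2 ⟨y, ?_, by rw [h]⟩)⟩
      simp only [faceUp, mem_filter]
      refine ⟨hy, ?_⟩
      rw [mem_periodBox] at hy hw
      push Not at hw
      obtain ⟨j, hj⟩ := hw
      by_cases hji : j = i
      · subst hji
        have := hy j
        rw [h] at hj
        simp only [Pi.add_apply, Pi.single_eq_same] at hj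
        omega
      · have := hy j
        rw [h] at hj
        simp only [Pi.add_apply, Pi.single_eq_of_ne hji, add_zero] at hj
        omega
    · refine ⟨i, mem_univ _, mem_union_right _ (mem_image.2 ⟨y, ?_, by rw [h, add_sub_cancel_right]⟩)⟩
      simp only [faceDn, mem_filter]
      refine ⟨hy, ?_⟩
      rw [mem_periodBox] at hy hw
      push Not at hw
      obtain ⟨j, hj⟩ := hw
      have hyj := hy j
      rw [h] at hyj
      have hyi : y i = w i + 1 := by rw [h]; simp
      by_cases hji : j = i
      · subst hji
        simp only [Pi.add_apply, Pi.single_eq_same] at hyj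
        omega
      · simp only [Pi.add_apply, Pi.single_eq_of_ne hji, add_zero] at hyj
        omega
  calc #B ≤ #((univ : Finset (Fin d)).biUnion fun i =>
        (faceUp i).image (fun y => (y, y + Pi.single i 1)) ∪ (faceDn i).image (fun y => (y, y - Pi.single i 1))) :=
        card_le_card hsub
    _ ≤ ∑ i : Fin d, #((faceUp i).image (fun y => (y, y + Pi.single i 1)) ∪ (faceDn i).image (fun y => (y, y - Pi.single i 1))) :=
        card_biUnion_le
    _ ≤ ∑ _i : Fin d, 2 * (K * L) ^ (d - 1) := sum_le_sum fun i _ => by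
        calc _ ≤ #((faceUp i).image (fun y => (y, y + Pi.single i 1))) + #((faceDn i).image (fun y => (y, y - Pi.single i 1))) :=
              card_union_le _ _
          _ ≤ #(faceUp i) + #(faceDn i) := add_le_add card_image_le card_image_le
          _ ≤ (K * L) ^ (d - 1) + (K * L) ^ (d - 1) := add_le_add (hface i _) (hface i _)
          _ = 2 * (K * L) ^ (d - 1) := by ring
    _ = 2 * d * (K * L) ^ (d - 1) := by rw [sum_const, card_univ, Fintype.card_fin, smul_eq_mul]; ring

end Proj

/-! ### The Peierls condition transferred to the torus -/

section Peierls

variable {N b : ℕ}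

variable (N b) in
/-- The lift of the frozen image spins of the torus to a periodic configuration of `ℤ^d`.
[cite: VanenterFernandezSokal1993, §4.3.2] -/
def liftPin (p : ℤˣ) : SpinConfig (Site d) := fun y => torusPin N b p (Torus.proj (N * b) y)

/-- The projection of `b·y` is the image point `tImg y`. [folklore] -/
theorem proj_mul_eq_tImg (y : Site d) : Torus.proj (N * b) (fun i => (b : ℤ) * y i) = tImg N b y := rfl

/-- **The lifted frozen pattern has isolated `-` spins** (the torus pattern alternates along the image
lattice, `torusPin_tImg_add_single`). [cite: VanenterFernandezSokal1993, §4.3.2 and App. B.5.3] -/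
theorem minusIsolated_liftPin (hN : Even N) (hb : 0 < b) (p : ℤˣ) : MinusIsolated d b (liftPin N b p) := by
  intro a ha hneg j s hs
  choose w hw using ha
  have haw : a = fun i => (b : ℤ) * w i := funext hw
  have hstep : a + (s * b) • (Pi.single j (1 : ℤ) : Site d) = fun i => (b : ℤ) * (w + s • (Pi.single j (1 : ℤ) : Site d)) i := by
    funext i
    simp only [haw, Pi.add_apply, Pi.smul_apply, smul_eq_mul]
    ring
  simp only [liftPin] at hneg ⊢
  rw [hstep, proj_mul_eq_tImg]
  rw [haw, proj_mul_eq_tImg] at hneg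
  rcases hs with rfl | rfl
  · rw [one_smul, torusPin_tImg_add_single hN hb, hneg, neg_neg]
  · have h := torusPin_tImg_add_single hN hb p (w + (-1 : ℤ) • (Pi.single j (1 : ℤ) : Site d)) j
    rw [show w + (-1 : ℤ) • (Pi.single j (1 : ℤ) : Site d) + Pi.single j 1 = w by
      rw [neg_one_smul, neg_add_cancel_right], hneg] at h
    have : torusPin N b p (tImg N b (w + (-1 : ℤ) • (Pi.single j (1 : ℤ) : Site d))) = 1 := by
      have h' := congrArg Neg.neg h
      rw [neg_neg, neg_neg] at h'
      exact h'.symm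
    exact this

variable [NeZero (N * b)]

variable (N b) in
/-- **The field of the frozen image spins at a site of the torus**: `h_x = ∑_{x' ∼ x image} ζ_{x'}`
(`ζ = torusPin N b p`). [cite: VanenterFernandezSokal1993, §4.3.2 ("a periodic magnetic field")] -/
def tField (p : ℤˣ) (x : TorusSite d (N * b)) : ℝ :=
  open Classical in
  ∑ x' ∈ ((torusGraph d (N * b)).neighborFinset x).filter (TImg N b), spinAt x' (torusPin N b p)

variable (N b) in
/-- **The internal boundary pairs of a set `M` of sites of the torus**: ordered pairs
`(x ∈ M, x' ∉ M internal)` of adjacent sites (for `M` the set of `-` internal spins of a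
configuration these are its frustrated internal bonds). [cite: VanenterFernandezSokal1993, App. B.5.3 (|Γ|)] -/
def ffPairsT (M : Finset (TorusSite d (N * b))) : Finset (TorusSite d (N * b) × TorusSite d (N * b)) :=
  (M ×ˢ tFree N b).filter fun q => q.2 ∉ M ∧ (torusGraph d (N * b)).Adj q.1 q.2

/-- Membership in `ffPairsT`. [cite: VanenterFernandezSokal1993, App. B.5.3] -/
theorem mem_ffPairsT {M : Finset (TorusSite d (N * b))} {q : TorusSite d (N * b) × TorusSite d (N * b)} :
    q ∈ ffPairsT N b M ↔ q.1 ∈ M ∧ q.2 ∈ tFree N b ∧ q.2 ∉ M ∧ (torusGraph d (N * b)).Adj q.1 q.2 := by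
  simp only [ffPairsT, mem_filter, mem_product, and_assoc]

variable (N b) in
/-- The lift of a set of torus sites to `K` periods in each direction. [folklore] -/
def liftSet (K : ℕ) (M : Finset (TorusSite d (N * b))) : Finset (Site d) :=
  (periodBox d K (N * b)).filter fun y => Torus.proj (N * b) y ∈ M

/-- **The lifted field is the torus field** (`L = Nb ≥ 3`): the image neighbours of `y` in `ℤ^d`
project bijectively onto the image neighbours of its projection. [cite: VanenterFernandezSokal1993, §4.3.2] -/
theorem imgField_liftPin (hL : 3 ≤ N * b) (p : ℤˣ) (y : Site d) :
    imgField d b (liftPin N b p) y = tField N b p (Torus.proj (N * b) y) := by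
  classical
  unfold imgField tField
  refine Finset.sum_bij (fun a _ => Torus.proj (N * b) a) (fun a ha => ?_) (fun a ha a' ha' h => ?_)
    (fun x' hx' => ?_) (fun a _ => rfl)
  · rw [mem_imgNbrs] at ha
    rw [mem_filter, SimpleGraph.mem_neighborFinset]
    exact ⟨torusGraph_adj_proj_of_adj (by omega) ha.1, tImg_proj_iff.2 ha.2⟩
  · exact eq_of_adj_of_adj_of_proj_eq hL (mem_imgNbrs.1 ha).1 (mem_imgNbrs.1 ha').1 h
  · rw [mem_filter, SimpleGraph.mem_neighborFinset] at hx'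
    obtain ⟨a, ha, rfl⟩ := (torusGraph_adj_proj_iff (by omega)).1 hx'.1
    exact ⟨a, mem_imgNbrs.2 ⟨ha, tImg_proj_iff.1 hx'.2⟩, rfl⟩

/-- **The fields of the lift add up to `K^d` times the torus fields.** [folklore] -/
theorem sum_imgField_liftSet (hL : 3 ≤ N * b) (p : ℤˣ) (K : ℕ) (M : Finset (TorusSite d (N * b))) :
    ∑ y ∈ liftSet N b K M, imgField d b (liftPin N b p) y = (K : ℝ) ^ d * ∑ x ∈ M, tField N b p x := by
  rw [liftSet, ← sum_filter_periodBox_comp_proj K M (tField N b p)]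
  exact sum_congr rfl fun y _ => imgField_liftPin hL p y

/-- **The internal boundary pairs of the lift**: at most `K^d` times those of `M`, plus the pairs
leaving the box of periods. [folklore] -/
theorem card_ffBdryPairs_liftSet_le (hL : 3 ≤ N * b) (K : ℕ) (M : Finset (TorusSite d (N * b))) :
    #(ffBdryPairs d b (liftSet N b K M)) ≤ K ^ d * #(ffPairsT N b M) + 2 * d * (K * (N * b)) ^ (d - 1) := by
  classical
  set S := liftSet N b K M with hS
  set Box := periodBox d K (N * b) with hBox
  set A := (ffBdryPairs d b S).filter fun q => q.2 ∈ Box with hA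
  set B := (ffBdryPairs d b S).filter fun q => q.2 ∉ Box with hB
  have hsplit : #(ffBdryPairs d b S) = #A + #B := by
    rw [hA, hB, card_filter_add_card_filter_not]
  have hSBox : S ⊆ Box := filter_subset _ _
  -- pairs leaving the box
  have hBle : #B ≤ 2 * d * (K * (N * b)) ^ (d - 1) := by
    refine le_trans (card_le_card fun q hq => ?_) (card_boxExitPairs_le K (N * b))
    rw [hB, mem_filter, mem_ffBdryPairs] at hq
    obtain ⟨⟨h1, -, -, hadj⟩, h2⟩ := hq
    rw [mem_filter, mem_product, mem_biUnion]
    exact ⟨⟨hSBox h1, q.1, hSBox h1, (SimpleGraph.mem_neighborFinset _ _ _).2 hadj⟩, h2, hadj⟩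
  -- pairs staying in the box inject into (lift point, torus boundary pair of `M`)
  have hAle : #A ≤ K ^ d * #(ffPairsT N b M) := by
    set T := (S ×ˢ (univ : Finset (TorusSite d (N * b)))).filter
      fun q => (Torus.proj (N * b) q.1, q.2) ∈ ffPairsT N b M with hT
    have hT_card : #T = K ^ d * #(ffPairsT N b M) := by
      rw [hT, card_filter_product_eq_sum]
      have h1 : ∑ u ∈ S, #((univ : Finset (TorusSite d (N * b))).filter
            fun x' => (Torus.proj (N * b) u, x') ∈ ffPairsT N b M) =
          K ^ d * ∑ x ∈ M, #((univ : Finset (TorusSite d (N * b))).filter fun x' => (x, x') ∈ ffPairsT N b M) := by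
        rw [hS, liftSet]
        exact sum_filter_periodBox_comp_proj_nat K M
          (fun x => #((univ : Finset (TorusSite d (N * b))).filter fun x' => (x, x') ∈ ffPairsT N b M))
      rw [h1]
      congr 1
      symm
      rw [card_eq_sum_card_fiberwise (f := Prod.fst) (t := M) fun q hq => (mem_ffPairsT.1 hq).1]
      refine sum_congr rfl fun x _ => ?_
      have hset : (ffPairsT N b M).filter (fun q => q.1 = x) =
          ((univ : Finset (TorusSite d (N * b))).filter fun x' => (x, x') ∈ ffPairsT N b M).image (Prod.mk x) := by
        ext q
        simp only [mem_filter, mem_image, mem_univ, true_and]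
        constructor
        · rintro ⟨hq, rfl⟩; exact ⟨q.2, hq, rfl⟩
        · rintro ⟨x', hx', rfl⟩; exact ⟨hx', rfl⟩
      rw [hset, card_image_of_injective _ (Prod.mk_right_injective x)]
    rw [← hT_card]
    refine card_le_card_of_injOn (fun q => (q.1, Torus.proj (N * b) q.2)) (fun q hq => ?_) ?_
    · rw [mem_coe, hA, mem_filter, mem_ffBdryPairs] at hq
      obtain ⟨⟨h1, h2, h3, hadj⟩, hbox⟩ := hq
      rw [mem_coe, hT, mem_filter, mem_product]
      refine ⟨⟨h1, mem_univ _⟩, mem_ffPairsT.2 ⟨(mem_filter.1 h1).2, ?_, ?_, torusGraph_adj_proj_of_adj (by omega) hadj⟩⟩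
      · exact mem_tFree.2 fun h => h3 (tImg_proj_iff.1 h)
      · intro hM; exact h2 (mem_filter.2 ⟨hbox, hM⟩)
    · rintro ⟨u, w⟩ hq ⟨u', w'⟩ hq' h
      simp only [Prod.mk.injEq] at h
      obtain ⟨rfl, hww⟩ := h
      rw [mem_coe, hA, mem_filter, mem_ffBdryPairs] at hq hq'
      simp only [Prod.mk.injEq, true_and]
      exact eq_of_adj_of_adj_of_proj_eq hL hq.1.2.2.2 hq'.1.2.2.2 hww
  rw [hsplit]
  exact add_le_add hAle hBle

/-- **The Peierls condition of App. B.5.3 on the torus**: for every set `M` of sites of the torus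
(`d ≥ 2`, `b ≥ 2`, `N ≥ 2` even, frozen alternating image spins of either parity) the field energy
released by turning the internal spins of `M` to `-` is at most half the number of internal boundary
pairs: `-∑_{x ∈ M} h_x ≤ #∂M / 2` (`H(ω_Γ | ω⁺) ≥ J|Γ|`). Transferred from `ℤ^d` (`sum_imgField_ge`)
by lifting `M` to `K` periods and letting `K → ∞`.
[cite: VanenterFernandezSokal1993, App. B.5.3 eqs. (B.71)–(B.77)] -/
theorem sum_tField_ge (hd : 2 ≤ d) (hN : Even N) (hN2 : 2 ≤ N) (hb : 2 ≤ b) (p : ℤˣ)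
    (M : Finset (TorusSite d (N * b))) :
    -(∑ x ∈ M, tField N b p x) ≤ (#(ffPairsT N b M) : ℝ) / 2 := by
  have hL : 3 ≤ N * b := le_trans (by norm_num) (Nat.mul_le_mul hN2 hb)
  set F : ℝ := (#(ffPairsT N b M) : ℝ) with hF
  set T : ℝ := ∑ x ∈ M, tField N b p x with hTdef
  set C : ℝ := (d : ℝ) * ((N * b : ℕ) : ℝ) ^ (d - 1) with hC
  have hC0 : 0 ≤ C := by positivity
  refine le_of_forall_pos_le_add fun ε hε => ?_
  -- a number of periods `K` with `C / K ≤ ε`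
  obtain ⟨K, hK1, hKε⟩ : ∃ K : ℕ, 1 ≤ K ∧ C / K ≤ ε := by
    refine ⟨⌈C / ε⌉₊ + 1, by omega, ?_⟩
    have hK : C / ε ≤ (⌈C / ε⌉₊ : ℝ) := Nat.le_ceil _
    have hKpos : (0 : ℝ) < ((⌈C / ε⌉₊ + 1 : ℕ) : ℝ) := by positivity
    rw [div_le_iff₀ hKpos]
    have hK' : C ≤ ε * (⌈C / ε⌉₊ : ℝ) := by rwa [div_le_iff₀' hε] at hK
    push_cast
    nlinarith
  have hK0 : (0 : ℝ) < K := by exact_mod_cast hK1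
  -- the lifted Peierls inequality
  have hP := sum_imgField_ge hd hb (minusIsolated_liftPin hN (by omega) p) (liftSet N b K M)
  rw [sum_imgField_liftSet hL p K M] at hP
  have hcardR : (#(ffBdryPairs d b (liftSet N b K M)) : ℝ) ≤ (K : ℝ) ^ d * F + 2 * d * ((K : ℝ) * (N * b : ℕ)) ^ (d - 1) := by
    have := card_ffBdryPairs_liftSet_le (d := d) hL K M
    rw [hF]
    exact_mod_cast this
  -- `K^d (-T) ≤ K^d F / 2 + C K^{d-1}`, divide by `K^d = K^{d-1} K`
  have hpow : (K : ℝ) ^ d = (K : ℝ) ^ (d - 1) * K := by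
    conv_lhs => rw [show d = d - 1 + 1 by omega]
    rw [pow_succ]
  rw [mul_pow] at hcardR
  have hc2 : (2 : ℝ) * d * ((K : ℝ) ^ (d - 1) * ((N * b : ℕ) : ℝ) ^ (d - 1)) = 2 * (C * (K : ℝ) ^ (d - 1)) := by
    rw [hC]; ring
  have h1 : (K : ℝ) ^ d * (-T) ≤ (K : ℝ) ^ d * (F / 2) + C * (K : ℝ) ^ (d - 1) := by
    linarith [hP, hcardR, hc2]
  have h3 : (K : ℝ) ^ d * (F / 2 + C / K) = (K : ℝ) ^ d * (F / 2) + C * (K : ℝ) ^ (d - 1) := by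
    rw [hpow]; field_simp
  have h2 : -T ≤ F / 2 + C / K := by
    rw [← h3] at h1
    exact le_of_mul_le_mul_left h1 (by positivity)
  linarith

end Peierls

/-! ### The energy of a pinned configuration above the ground state `ω⁺` -/

section Energy

variable {N b : ℕ} [NeZero (N * b)]

variable (N b) in
/-- **The ground configuration `ω⁺` of the torus**: frozen pattern at the image sites, `+1` at the
internal sites. [cite: VanenterFernandezSokal1993, App. B.5.3 (ω^{(+)})] -/
def tPlus (p : ℤˣ) : SpinConfig (TorusSite d (N * b)) :=
  open Classical in fun x => if TImg N b x then torusPin N b p x else 1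

variable (N b) in
/-- The `-` internal spins of a configuration. [cite: VanenterFernandezSokal1993, App. B.5.3] -/
def minusSet (σ : SpinConfig (TorusSite d (N * b))) : Finset (TorusSite d (N * b)) :=
  (tFree N b).filter fun x => σ x = -1

/-- Membership in `minusSet`. [cite: VanenterFernandezSokal1993, App. B.5.3] -/
theorem mem_minusSet {σ : SpinConfig (TorusSite d (N * b))} {x : TorusSite d (N * b)} :
    x ∈ minusSet N b σ ↔ x ∈ tFree N b ∧ σ x = -1 := by
  rw [minusSet, mem_filter]

/-- `ω⁺` is a pinned configuration. [cite: VanenterFernandezSokal1993, App. B.5.3] -/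
theorem tPlus_mem_tOmega (p : ℤˣ) : tPlus N b p ∈ tOmega (d := d) N b p := by
  classical
  refine mem_tOmega.2 fun x hx => ?_
  rw [mem_tFree, not_not] at hx
  simp [tPlus, hx]

/-- `ω⁺` is `+1` at internal sites. [cite: VanenterFernandezSokal1993, App. B.5.3] -/
theorem tPlus_of_mem_tFree (p : ℤˣ) {x : TorusSite d (N * b)} (hx : x ∈ tFree N b) : tPlus N b p x = 1 := by
  classical
  rw [mem_tFree] at hx
  simp [tPlus, hx]

/-- **A pinned configuration is `ω⁺` flipped on its `-` internal spins.**
[cite: VanenterFernandezSokal1993, App. B.5.3 (ω_Γ)] -/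
theorem flipOn_minusSet_tPlus {p : ℤˣ} {σ : SpinConfig (TorusSite d (N * b))} (hσ : σ ∈ tOmega N b p) :
    flipOn (minusSet N b σ) (tPlus N b p) = σ := by
  classical
  funext x
  by_cases hx : x ∈ minusSet N b σ
  · rw [flipOn_apply_of_mem _ hx]
    obtain ⟨hxf, hσx⟩ := mem_minusSet.1 hx
    rw [tPlus_of_mem_tFree p hxf, hσx]
  · rw [flipOn_apply_of_notMem _ hx]
    by_cases hxf : x ∈ tFree N b
    · rw [tPlus_of_mem_tFree p hxf]
      rcases Int.units_eq_one_or (σ x) with h | h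
      · rw [h]
      · exact absurd (mem_minusSet.2 ⟨hxf, h⟩) hx
    · rw [mem_tOmega.1 hσ x hxf]
      rw [mem_tFree, not_not] at hxf
      simp [tPlus, hxf]

/-- On the whole torus the Hamiltonian with a fixed boundary condition is the free one. [folklore] -/
theorem isingHamiltonian_univ_fixed_eq (η σ : SpinConfig (TorusSite d (N * b))) (h : ℝ) :
    isingHamiltonian (torusGraph d (N * b)) univ h (.fixed η) σ = isingHamiltonian (torusGraph d (N * b)) univ h .free σ := by
  simp only [isingHamiltonian, interactionEdges_fixed, interactionEdges_free, edgesTouching_univ]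

/-- **The relative energy (B.71) on the torus**: for a pinned configuration `σ` with `-` internal spins
`M`, `H(σ) - H(ω⁺) = 2·#∂M + 2∑_{x ∈ M} h_x` — the broken internal bonds and the field energy
(van Enter–Fernández–Sokal (B.71): `H(ω_Γ|ω⁺) = 2J|Γ| - ΔE₋ + ΔE₊`).
[cite: VanenterFernandezSokal1993, App. B.5.3 eq. (B.71)] -/
theorem isingHamiltonian_sub_tPlus {p : ℤˣ} {σ : SpinConfig (TorusSite d (N * b))} (hσ : σ ∈ tOmega N b p) :
    isingHamiltonian (torusGraph d (N * b)) univ 0 .free σ - isingHamiltonian (torusGraph d (N * b)) univ 0 .free (tPlus N b p) =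
      2 * #(ffPairsT N b (minusSet N b σ)) + 2 * ∑ x ∈ minusSet N b σ, tField N b p x := by
  classical
  set T := minusSet N b σ with hT
  have hflip := isingHamiltonian_sub_isingHamiltonian_flipOn (torusGraph d (N * b)) (subset_univ T) 0 (tPlus N b p) (tPlus N b p)
  rw [flipOn_minusSet_tPlus hσ, isingHamiltonian_univ_fixed_eq, isingHamiltonian_univ_fixed_eq,
    sum_edgeBoundary_bondSpin] at hflip
  simp only [mul_zero, zero_mul, sub_zero] at hflip
  -- the boundary sum at a `-` internal spin: image neighbours give the field, internal ones the broken bonds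
  have hTfree : T ⊆ tFree N b := filter_subset _ _
  have hsite : ∀ y ∈ T, spinAt y (tPlus N b p) * ∑ z ∈ outNbrs (torusGraph d (N * b)) T y, spinAt z (tPlus N b p) =
      tField N b p y + #((tFree N b).filter fun x' => x' ∉ T ∧ (torusGraph d (N * b)).Adj y x') := by
    intro y hy
    rw [spinAt, tPlus_of_mem_tFree p (hTfree hy)]
    simp only [Units.val_one, Int.cast_one, one_mul]
    rw [← sum_filter_add_sum_filter_not (outNbrs (torusGraph d (N * b)) T y) (TImg N b)]
    congr 1
    · -- image neighbours
      rw [tField]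
      refine sum_congr ?_ fun z hz => ?_
      · ext z
        simp only [mem_filter, mem_outNbrs, SimpleGraph.mem_neighborFinset]
        constructor
        · rintro ⟨⟨hadj, -⟩, hz⟩; exact ⟨hadj, hz⟩
        · rintro ⟨hadj, hz⟩; exact ⟨⟨hadj, fun hzT => (mem_tFree.1 (hTfree hzT)) hz⟩, hz⟩
      · have hz' : TImg N b z := (mem_filter.1 hz).2
        simp [spinAt, tPlus, hz']
    · -- internal neighbours outside `T` are `+1`
      rw [sum_congr rfl fun z hz => by
        rw [spinAt, tPlus_of_mem_tFree p (mem_tFree.2 (mem_filter.1 hz).2)]]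
      simp only [Units.val_one, Int.cast_one, sum_const, nsmul_eq_mul, mul_one]
      congr 1
      congr 1
      ext z
      simp only [mem_filter, mem_outNbrs, mem_tFree]
      tauto
  rw [sum_congr rfl hsite, sum_add_distrib] at hflip
  -- the broken bonds
  have hcard : ∑ y ∈ T, (#((tFree N b).filter fun x' => x' ∉ T ∧ (torusGraph d (N * b)).Adj y x') : ℝ) =
      #(ffPairsT N b T) := by
    rw [card_eq_sum_card_fiberwise (f := Prod.fst) (s := ffPairsT N b T) (t := T) fun q hq => (mem_ffPairsT.1 hq).1]
    push_cast
    refine sum_congr rfl fun y hy => ?_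
    have hset : (ffPairsT N b T).filter (fun q => q.1 = y) =
        ((tFree N b).filter fun x' => x' ∉ T ∧ (torusGraph d (N * b)).Adj y x').image (Prod.mk y) := by
      ext q
      simp only [mem_filter, mem_image, mem_ffPairsT]
      constructor
      · rintro ⟨⟨-, h2, h3, h4⟩, rfl⟩; exact ⟨q.2, ⟨h2, h3, h4⟩, rfl⟩
      · rintro ⟨x', ⟨h2, h3, h4⟩, rfl⟩; exact ⟨⟨hy, h2, h3, h4⟩, rfl⟩
    rw [hset, card_image_of_injective _ (Prod.mk_right_injective y)]
  rw [hcard] at hflip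
  linarith

/-- **The Peierls estimate on the torus, energy form**: for a pinned configuration the energy above
`ω⁺` is at least the number of broken internal bonds, `H(σ) - H(ω⁺) ≥ #∂M` (`d ≥ 2`, `b ≥ 2`,
`N ≥ 2` even; App. B.5.3 with Peierls constant `1/2` in place of `1 - M_{d,b}`).
[cite: VanenterFernandezSokal1993, App. B.5.3 eqs. (B.71)–(B.77)] -/
theorem card_ffPairsT_le_energy (hd : 2 ≤ d) (hN : Even N) (hN2 : 2 ≤ N) (hb : 2 ≤ b) {p : ℤˣ}
    {σ : SpinConfig (TorusSite d (N * b))} (hσ : σ ∈ tOmega N b p) :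
    (#(ffPairsT N b (minusSet N b σ)) : ℝ) ≤
      isingHamiltonian (torusGraph d (N * b)) univ 0 .free σ - isingHamiltonian (torusGraph d (N * b)) univ 0 .free (tPlus N b p) := by
  rw [isingHamiltonian_sub_tPlus hσ]
  have := sum_tField_ge hd hN hN2 hb p (minusSet N b σ)
  linarith

end Energy

/-! ### Bad cells contain broken internal bonds -/

section BadCells

variable {N b : ℕ}

/-- Upward unit steps of `ℤ^d` along coordinate `k` inside a set `P`: a chain of nearest-neighbour
steps with all points in `P`. [folklore] -/
theorem reflTransGen_update_add_zd {P : Site d → Prop} (y : Site d) (k : Fin d) (n : ℕ)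
    (h : ∀ m : ℕ, m ≤ n → P (Function.update y k (y k + m))) :
    ReflTransGen (fun a c => (zdGraph d).Adj a c ∧ P a ∧ P c) y (Function.update y k (y k + n)) := by
  induction n with
  | zero =>
    simp only [Nat.cast_zero, add_zero, Function.update_eq_self]
    exact ReflTransGen.refl
  | succ n ih =>
    refine (ih fun m hm => h m (by omega)).tail ⟨?_, h n (by omega), h (n + 1) le_rfl⟩
    rw [zdGraph_adj_iff]
    refine ⟨k, Or.inl ?_⟩
    funext j
    by_cases hj : j = k
    · subst hj; simp; ring
    · simp [hj]

/-- Downward unit steps of `ℤ^d` along coordinate `k` inside a set `P`. [folklore] -/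
theorem reflTransGen_update_sub_zd {P : Site d → Prop} (y : Site d) (k : Fin d) (n : ℕ)
    (h : ∀ m : ℕ, m ≤ n → P (Function.update y k (y k - m))) :
    ReflTransGen (fun a c => (zdGraph d).Adj a c ∧ P a ∧ P c) y (Function.update y k (y k - n)) := by
  induction n with
  | zero =>
    simp only [Nat.cast_zero, sub_zero, Function.update_eq_self]
    exact ReflTransGen.refl
  | succ n ih =>
    refine (ih fun m hm => h m (by omega)).tail ⟨?_, h n (by omega), h (n + 1) le_rfl⟩
    rw [zdGraph_adj_iff]
    refine ⟨k, Or.inr ?_⟩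
    funext j
    by_cases hj : j = k
    · subst hj; simp; ring
    · simp [hj]

/-- Moving one coordinate monotonically to a prescribed value inside a set `P` containing the segment.
[folklore] -/
theorem reflTransGen_update_between_zd {P : Site d → Prop} (y : Site d) (k : Fin d) (v : ℤ)
    (h : ∀ w : ℤ, min (y k) v ≤ w → w ≤ max (y k) v → P (Function.update y k w)) :
    ReflTransGen (fun a c => (zdGraph d).Adj a c ∧ P a ∧ P c) y (Function.update y k v) := by
  rcases le_or_gt (y k) v with hle | hlt
  · obtain ⟨n, hn⟩ := Int.le.dest hle
    rw [← hn]
    refine reflTransGen_update_add_zd y k n fun m hm => h _ ?_ ?_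
    · rw [min_eq_left hle]; omega
    · rw [max_eq_right hle]; omega
  · obtain ⟨n, hn⟩ := Int.le.dest hlt.le
    rw [show v = y k - n by omega]
    refine reflTransGen_update_sub_zd y k n fun m hm => h _ ?_ ?_
    · rw [min_eq_right hlt.le]; omega
    · rw [max_eq_left hlt.le]; omega

/-- Along a chain between points with different values of `f`, some step changes the value. [folklore] -/
theorem exists_rel_ne_of_reflTransGen {α β : Type*} {R : α → α → Prop} {f : α → β} {a c : α}
    (h : ReflTransGen R a c) (hne : f a ≠ f c) : ∃ x y, R x y ∧ f x ≠ f y := by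
  induction h with
  | refl => exact absurd rfl hne
  | @tail x y _ hxy ih =>
    by_cases hfx : f a = f x
    · exact ⟨x, y, hxy, fun h => hne (hfx.trans h)⟩
    · exact ih hfx

/-- A multiple of `b` in a closed interval `[bc, bc + b]` is an endpoint; a non-multiple is strictly
inside, and every integer strictly inside is a non-multiple. [folklore] -/
theorem not_dvd_of_lt_of_lt {c w : ℤ} (hb : 0 < b) (h1 : (b : ℤ) * c < w) (h2 : w < (b : ℤ) * c + b) : ¬ (b : ℤ) ∣ w := by
  rintro ⟨t, rfl⟩
  have hbz : (0 : ℤ) < b := by exact_mod_cast hb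
  have h1' : c < t := by nlinarith
  have h2' : t < c + 1 := by nlinarith
  omega

/-- A non-multiple of `b` in `[bc, bc + b]` lies strictly inside. [folklore] -/
theorem lt_and_lt_of_not_dvd {c w : ℤ} (h1 : (b : ℤ) * c ≤ w) (h2 : w ≤ (b : ℤ) * c + b) (hw : ¬ (b : ℤ) ∣ w) :
    (b : ℤ) * c < w ∧ w < (b : ℤ) * c + b := by
  refine ⟨lt_of_le_of_ne h1 fun h => hw ⟨c, by rw [← h]⟩, lt_of_le_of_ne h2 fun h => hw ⟨c + 1, by rw [h]; ring⟩⟩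

/-- **One-coordinate moves inside the internal sites of a cell**: if `y ∈ cellZ b c`, the target value of
coordinate `k` is admissible, and either some other coordinate of `y` is not divisible by `b` or both the
current and the target `k`-th coordinates are not, then `y` is chained to `y[k ↦ v]` by internal bonds
inside the cell. [cite: VanenterFernandezSokal1993, §4.3.2 (the internal spins)] -/
theorem reflTransGen_freeCellZ_update (hb : 0 < b) {c y : Site d} (hy : y ∈ cellZ b c) (k : Fin d) {v : ℤ}
    (hv : (b : ℤ) * c k ≤ v ∧ v ≤ (b : ℤ) * c k + b)
    (hwit : (∃ i, i ≠ k ∧ ¬ (b : ℤ) ∣ y i) ∨ (¬ (b : ℤ) ∣ y k ∧ ¬ (b : ℤ) ∣ v)) :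
    ReflTransGen (fun a e => (zdGraph d).Adj a e ∧ a ∈ freeCellZ b c ∧ e ∈ freeCellZ b c) y (Function.update y k v) := by
  refine reflTransGen_update_between_zd (P := fun a => a ∈ freeCellZ b c) y k v fun w hw1 hw2 => ?_
  have hyk := (mem_cellZ.1 hy) k
  have hcell : Function.update y k w ∈ cellZ b c := by
    rw [mem_cellZ]; intro j
    by_cases hj : j = k
    · subst hj; rw [Function.update_self]
      constructor
      · exact le_trans (le_min hyk.1 hv.1) hw1
      · exact le_trans hw2 (max_le hyk.2 hv.2)
    · rw [Function.update_of_ne hj]; exact (mem_cellZ.1 hy) j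
  refine mem_freeCellZ.2 ⟨hcell, fun himg => ?_⟩
  rcases hwit with ⟨i, hik, hi⟩ | ⟨hyk', hv'⟩
  · exact hi (by simpa [Function.update_of_ne hik] using himg i)
  · have hwk : (b : ℤ) ∣ w := by simpa using himg k
    obtain ⟨l1, l2⟩ := lt_and_lt_of_not_dvd hyk.1 hyk.2 hyk'
    obtain ⟨l3, l4⟩ := lt_and_lt_of_not_dvd hv.1 hv.2 hv'
    refine not_dvd_of_lt_of_lt (c := c k) hb ?_ ?_ hwk
    · exact lt_of_lt_of_le (lt_min l1 l3) hw1
    · exact lt_of_le_of_lt hw2 (max_lt l2 l4)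

/-- **The internal sites of a closed cell are connected by internal bonds** (`b ≥ 1`): any two of them are
joined by a chain of nearest-neighbour internal sites of the cell.
[cite: VanenterFernandezSokal1993, §4.3.2 (the internal spins)] -/
theorem reflTransGen_freeCellZ (hb : 0 < b) {c u v : Site d} (hu : u ∈ freeCellZ b c) (hv : v ∈ freeCellZ b c) :
    ReflTransGen (fun a e => (zdGraph d).Adj a e ∧ a ∈ freeCellZ b c ∧ e ∈ freeCellZ b c) u v := by
  classical
  obtain ⟨huc, huimg⟩ := mem_freeCellZ.1 hu
  obtain ⟨hvc, hvimg⟩ := mem_freeCellZ.1 hv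
  obtain ⟨i₀, hi₀⟩ : ∃ i, ¬ (b : ℤ) ∣ u i := not_forall.1 huimg
  obtain ⟨i₁, hi₁⟩ : ∃ i, ¬ (b : ℤ) ∣ v i := not_forall.1 hvimg
  -- phase 1: bring the coordinates other than `i₀` to those of `v`
  set z : Finset (Fin d) → Site d := fun S i => if i ∈ S then v i else u i with hz
  have hzcell : ∀ S, z S ∈ cellZ b c := fun S => mem_cellZ.2 fun j => by
    simp only [hz]; split_ifs
    · exact (mem_cellZ.1 hvc) j
    · exact (mem_cellZ.1 huc) j
  have phase1 : ∀ S : Finset (Fin d), i₀ ∉ S →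
      ReflTransGen (fun a e => (zdGraph d).Adj a e ∧ a ∈ freeCellZ b c ∧ e ∈ freeCellZ b c) u (z S) := by
    intro S
    induction S using Finset.induction_on with
    | empty =>
      intro _
      have : z ∅ = u := funext fun i => by simp [hz]
      rw [this]
    | insert k S hkS ih =>
      intro hnot
      rw [mem_insert, not_or] at hnot
      have hstep : z (insert k S) = Function.update (z S) k (v k) := by
        funext j
        by_cases hj : j = k
        · subst hj; simp [hz]
        · simp [hz, hj]
      rw [hstep]
      refine (ih hnot.2).trans (reflTransGen_freeCellZ_update hb (hzcell S) k ((mem_cellZ.1 hvc) k) (Or.inl ⟨i₀, hnot.1, ?_⟩))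
      simp only [hz, if_neg hnot.2]; exact hi₀
  have h1 := phase1 (univ.erase i₀) (notMem_erase i₀ _)
  -- phase 2: the coordinate `i₀`
  have hz1 : Function.update (z (univ.erase i₀)) i₀ (v i₀) = v := by
    funext j
    by_cases hj : j = i₀
    · subst hj; simp
    · simp [hz, hj]
  rw [← hz1]
  refine h1.trans (reflTransGen_freeCellZ_update hb (hzcell _) i₀ ((mem_cellZ.1 hvc) i₀) ?_)
  by_cases h10 : i₁ = i₀
  · subst h10
    right
    refine ⟨?_, hi₁⟩
    simp only [hz, mem_erase, ne_eq, not_true_eq_false, false_and, if_false]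
    exact hi₀
  · left
    refine ⟨i₁, h10, ?_⟩
    simp only [hz, mem_erase, ne_eq, h10, not_false_eq_true, mem_univ, and_self, if_true]
    exact hi₁

/-- **A bad cell contains a broken internal bond**: two adjacent internal sites of the cell with
different spins. [cite: FriedliVelenik2017, §10.4.2] -/
theorem exists_adj_ne_of_badCell (hb : 0 < b) {c : Site d} {σ : SpinConfig (TorusSite d (N * b))}
    (h : BadCell N b c σ) :
    ∃ w w', w ∈ freeCellZ b c ∧ w' ∈ freeCellZ b c ∧ (zdGraph d).Adj w w' ∧
      σ (Torus.proj (N * b) w) ≠ σ (Torus.proj (N * b) w') := by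
  obtain ⟨u, hu, v, hv, huv⟩ := h
  obtain ⟨w, w', ⟨hadj, hw, hw'⟩, hne⟩ :=
    exists_rel_ne_of_reflTransGen (f := fun y => σ (Torus.proj (N * b) y)) (reflTransGen_freeCellZ hb hu hv) huv
  exact ⟨w, w', hw, hw', hadj, hne⟩

variable [NeZero (N * b)]

/-- **A bad cell contributes a broken internal bond of the configuration**, one of whose endpoints is
the projection of a point of the cell. [cite: FriedliVelenik2017, §10.4.2] -/
theorem exists_mem_ffPairsT_of_badCell (hL : 2 ≤ N * b) (hb : 0 < b) {c : Site d}
    {σ : SpinConfig (TorusSite d (N * b))} (h : BadCell N b c σ) :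
    ∃ q ∈ ffPairsT N b (minusSet N b σ), ∃ w ∈ cellZ b c, q.1 = Torus.proj (N * b) w := by
  obtain ⟨w, w', hw, hw', hadj, hne⟩ := exists_adj_ne_of_badCell hb h
  have hwf : Torus.proj (N * b) w ∈ tFree N b := mem_tFree.2 fun hi => (mem_freeCellZ.1 hw).2 (tImg_proj_iff.1 hi)
  have hwf' : Torus.proj (N * b) w' ∈ tFree N b := mem_tFree.2 fun hi => (mem_freeCellZ.1 hw').2 (tImg_proj_iff.1 hi)
  have hadjT := torusGraph_adj_proj_of_adj hL hadj
  rcases Int.units_eq_one_or (σ (Torus.proj (N * b) w)) with h1 | h1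
  · -- then `σ(w') = -1`: the pair `(w', w)`
    have h2 : σ (Torus.proj (N * b) w') = -1 := by
      rcases Int.units_eq_one_or (σ (Torus.proj (N * b) w')) with h2 | h2
      · exact absurd (h1.trans h2.symm) hne
      · exact h2
    refine ⟨(Torus.proj (N * b) w', Torus.proj (N * b) w), mem_ffPairsT.2 ⟨mem_minusSet.2 ⟨hwf', h2⟩, hwf, ?_, hadjT.symm⟩,
      w', (mem_freeCellZ.1 hw').1, rfl⟩
    intro hm; rw [(mem_minusSet.1 hm).2] at h1; exact absurd h1 (by decide)
  · have h2 : σ (Torus.proj (N * b) w') = 1 := by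
      rcases Int.units_eq_one_or (σ (Torus.proj (N * b) w')) with h2 | h2
      · exact h2
      · exact absurd (h1.trans h2.symm) hne
    refine ⟨(Torus.proj (N * b) w, Torus.proj (N * b) w'), mem_ffPairsT.2 ⟨mem_minusSet.2 ⟨hwf, h1⟩, hwf', ?_, hadjT⟩,
      w, (mem_freeCellZ.1 hw).1, rfl⟩
    intro hm; rw [(mem_minusSet.1 hm).2] at h2; exact absurd h2 (by decide)

/-- **If all cells are bad, at least `(N/2)^d` internal bonds are broken**: the even cells
`[2jb, 2jb + b]^d`, `j ∈ {0, …, N/2 - 1}^d`, are pairwise disjoint inside one period, and each contains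
a broken bond. [cite: FriedliVelenik2017, §10.4.2 and Theorem 10.11 (the universal contour)] -/
theorem card_ffPairsT_ge_of_forall_badCell (hN2 : 2 ≤ N) (hb : 1 ≤ b) {σ : SpinConfig (TorusSite d (N * b))}
    (h : ∀ c : Site d, BadCell N b c σ) : (N / 2) ^ d ≤ #(ffPairsT N b (minusSet N b σ)) := by
  classical
  have hL : 2 ≤ N * b := le_trans (by omega) (Nat.mul_le_mul hN2 hb)
  set J : Finset (Fin d → ℕ) := Fintype.piFinset fun _ => range (N / 2) with hJ
  have hJcard : #J = (N / 2) ^ d := by rw [hJ, Fintype.card_piFinset_const, card_range]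
  -- choose a broken bond in each even cell
  have hchoose : ∀ j : Fin d → ℕ, ∃ q, q ∈ ffPairsT N b (minusSet N b σ) ∧
      ∃ w ∈ cellZ b (fun i => (2 * j i : ℤ)), q.1 = Torus.proj (N * b) w :=
    fun j => by
      obtain ⟨q, hq, w, hw, hqw⟩ := exists_mem_ffPairsT_of_badCell hL (by omega) (h fun i => (2 * j i : ℤ))
      exact ⟨q, hq, w, hw, hqw⟩
  choose g hg using hchoose
  rw [← hJcard]
  refine card_le_card_of_injOn g (fun j _ => (hg j).1) fun j hj j' hj' hgg => ?_
  obtain ⟨w, hw, hqw⟩ := (hg j).2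
  obtain ⟨w', hw', hqw'⟩ := (hg j').2
  have hproj : Torus.proj (N * b) w = Torus.proj (N * b) w' := by rw [← hqw, ← hqw', hgg]
  rw [mem_coe, hJ, Fintype.mem_piFinset] at hj hj'
  -- both points lie in `[0, Nb - b]^d`, so they coincide
  have hbz : (1 : ℤ) ≤ b := by exact_mod_cast hb
  have hrange : ∀ (j : Fin d → ℕ) (w : Site d), (∀ i, j i ∈ range (N / 2)) → w ∈ cellZ b (fun i => (2 * j i : ℤ)) →
      ∀ i, 0 ≤ w i ∧ w i + b ≤ N * b := by
    intro j w hj hw i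
    have hji : j i < N / 2 := mem_range.1 (hj i)
    have hji' : (2 * j i : ℤ) + 2 ≤ N := by
      have : 2 * j i + 2 ≤ N := by omega
      exact_mod_cast this
    obtain ⟨h1, h2⟩ := (mem_cellZ.1 hw) i
    constructor <;> nlinarith
  have hww : w = w' := by
    refine eq_of_proj_eq_of_abs_lt hproj fun i => ?_
    have h1 := hrange j w hj hw i
    have h2 := hrange j' w' hj' hw' i
    rw [abs_lt]
    push_cast
    constructor <;> nlinarith
  subst hww
  funext i
  obtain ⟨h1, h2⟩ := (mem_cellZ.1 hw) i
  obtain ⟨h3, h4⟩ := (mem_cellZ.1 hw') i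
  have : (j i : ℤ) = j' i := by nlinarith
  exact_mod_cast this

end BadCells

/-! ### The dissemination bound -/

section Dissemination

variable {N b : ℕ} [NeZero N] [NeZero (N * b)]

omit [NeZero N] in
/-- The number of pinned configurations is at most `2^{(Nb)^d}`. [folklore] -/
theorem card_tOmega_le (p : ℤˣ) : #(tOmega (d := d) N b p) ≤ 2 ^ ((N * b) ^ d) := by
  classical
  rw [tOmega_eq_image]
  refine le_trans card_image_le ?_
  rw [card_univ, Fintype.card_fun, Fintype.card_coe, Fintype.card_units_int]
  refine Nat.pow_le_pow_right (by norm_num) ?_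
  calc #(tFree N b) ≤ #(univ : Finset (TorusSite d (N * b))) := card_le_card (subset_univ _)
    _ = (N * b) ^ d := by rw [card_univ, Fintype.card_pi]; simp [ZMod.card]

omit [NeZero N] in
/-- **The weight of an all-bad pinned configuration**: if every cell is bad then
`e^{-βH(σ)} ≤ e^{-βH(ω⁺)} e^{-β(N/2)^d}` (`β ≥ 0`). [cite: FriedliVelenik2017, Theorem 10.11 (the universal contour)] -/
theorem exp_le_of_forall_badCell (hd : 2 ≤ d) (hN : Even N) (hN2 : 2 ≤ N) (hb : 2 ≤ b) {p : ℤˣ} {β : ℝ} (hβ : 0 ≤ β)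
    {σ : SpinConfig (TorusSite d (N * b))} (hσ : σ ∈ tOmega N b p) (hbad : ∀ c : Site d, BadCell N b c σ) :
    Real.exp (-β * isingHamiltonian (torusGraph d (N * b)) univ 0 .free σ) ≤
      Real.exp (-β * isingHamiltonian (torusGraph d (N * b)) univ 0 .free (tPlus N b p)) *
        Real.exp (-β * (((N / 2) ^ d : ℕ) : ℝ)) := by
  rw [← Real.exp_add]
  refine Real.exp_le_exp.2 ?_
  have h1 := card_ffPairsT_le_energy hd hN hN2 hb hσ
  have h2 : (((N / 2) ^ d : ℕ) : ℝ) ≤ #(ffPairsT N b (minusSet N b σ)) := by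
    exact_mod_cast card_ffPairsT_ge_of_forall_badCell hN2 (by omega) hbad
  nlinarith

/-- **The dissemination bound** (the "universal contour" of the chessboard–Peierls argument,
Friedli–Velenik Theorem 10.11 / §10.4.2; Fröhlich–Lieb 1978 §4): on the torus `(ℤ/Nbℤ)^d` with
`N = 2^(n+1)`, `d ≥ 2`, `b ≥ 2`, frozen alternating image spins of either parity and `β ≥ 0`, the
probability that ALL cells are bad is at most `(2^{b^d} e^{-β/2^d})^{N^d}`: there are at most
`2^{(Nb)^d}` pinned configurations, and an all-bad one has at least `(N/2)^d` broken internal bonds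
(`card_ffPairsT_ge_of_forall_badCell`), hence by the Peierls condition (`card_ffPairsT_le_energy`) a
Boltzmann weight at most `e^{-β(N/2)^d}` times that of `ω⁺`.
[cite: FriedliVelenik2017, Theorem 10.11 and §10.4.2] -/
theorem tExpect_prodBad_univ_le {n : ℕ} (hd : 2 ≤ d) (hNn : N = 2 ^ (n + 1)) (hb : 2 ≤ b) (p : ℤˣ) {β : ℝ}
    (hβ : 0 ≤ β) :
    tExpect N b p β (prodBad N b (univ : Finset (BlockIdx d N))) ≤
      ((2 : ℝ) ^ (b ^ d) * Real.exp (-β / 2 ^ d)) ^ (N ^ d) := by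
  classical
  have hN : Even N := hNn ▸ Nat.even_pow.2 ⟨even_two, Nat.succ_ne_zero n⟩
  have hN2 : 2 ≤ N := by
    rw [hNn]; calc 2 = 2 ^ 1 := by norm_num
      _ ≤ 2 ^ (n + 1) := Nat.pow_le_pow_right (by norm_num) (by omega)
  set H : SpinConfig (TorusSite d (N * b)) → ℝ := fun σ => isingHamiltonian (torusGraph d (N * b)) univ 0 .free σ with hH
  set w₀ := Real.exp (-β * H (tPlus N b p)) with hw₀
  set δ := Real.exp (-β * (((N / 2) ^ d : ℕ) : ℝ)) with hδ
  have hw₀pos : 0 < w₀ := Real.exp_pos _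
  -- numerator
  have hnum : tBsum N b p β (prodBad N b (univ : Finset (BlockIdx d N))) ≤ #(tOmega (d := d) N b p) * (w₀ * δ) := by
    rw [tBsum]
    calc ∑ σ ∈ tOmega N b p, Real.exp (-β * H σ) * prodBad N b univ σ
        ≤ ∑ σ ∈ tOmega N b p, w₀ * δ := sum_le_sum fun σ hσ => ?_
      _ = #(tOmega (d := d) N b p) * (w₀ * δ) := by rw [sum_const, nsmul_eq_mul]
    by_cases hall : ∀ c : Site d, BadCell N b c σ
    · calc Real.exp (-β * H σ) * prodBad N b univ σ ≤ Real.exp (-β * H σ) * 1 :=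
            mul_le_mul_of_nonneg_left (prodBad_le_one _ σ) (Real.exp_pos _).le
        _ ≤ w₀ * δ := by rw [mul_one]; exact exp_le_of_forall_badCell hd hN hN2 hb hβ hσ hall
    · -- some cell is good: the product of indicators vanishes
      push Not at hall
      obtain ⟨c, hc⟩ := hall
      have hzero : prodBad N b (univ : Finset (BlockIdx d N)) σ = 0 := by
        rw [prodBad]
        refine prod_eq_zero (mem_univ fun i => (c i : ZMod N)) ?_
        rw [badIdx_intCast, badInd, if_neg hc]
      rw [hzero, mul_zero]
      positivity
  -- denominator
  have hden : w₀ ≤ tBsum N b p β (fun _ : SpinConfig (TorusSite d (N * b)) => (1 : ℝ)) := by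
    rw [tBsum]
    have := single_le_sum (f := fun σ => Real.exp (-β * H σ) * (1 : ℝ)) (fun σ _ => by positivity) (tPlus_mem_tOmega (d := d) p)
    simpa [hw₀] using this
  -- the ratio
  have hratio : tExpect N b p β (prodBad N b (univ : Finset (BlockIdx d N))) ≤ #(tOmega (d := d) N b p) * δ := by
    rw [tExpect_eq_tBsum_div hb]
    rw [div_le_iff₀ (tBsum_one_pos p β)]
    calc tBsum N b p β (prodBad N b univ) ≤ #(tOmega (d := d) N b p) * (w₀ * δ) := hnum
      _ = #(tOmega (d := d) N b p) * δ * w₀ := by ring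
      _ ≤ #(tOmega (d := d) N b p) * δ * tBsum N b p β (fun _ => (1 : ℝ)) :=
          mul_le_mul_of_nonneg_left hden (by positivity)
  -- arithmetic: `#Ω ≤ 2^{(Nb)^d} = (2^{b^d})^{N^d}`, `δ = (e^{-β/2^d})^{N^d}`
  have hcard : (#(tOmega (d := d) N b p) : ℝ) ≤ ((2 : ℝ) ^ (b ^ d)) ^ (N ^ d) := by
    rw [← pow_mul, show b ^ d * N ^ d = (N * b) ^ d by rw [mul_pow, mul_comm]]
    exact_mod_cast card_tOmega_le (d := d) (N := N) (b := b) p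
  have hδ' : δ = Real.exp (-β / 2 ^ d) ^ (N ^ d) := by
    rw [hδ, ← Real.exp_nat_mul]
    congr 1
    have hhalf : ((N / 2 : ℕ) : ℝ) * 2 = N := by
      obtain ⟨m, hm⟩ := hN
      have : N / 2 = m := by omega
      rw [this, hm]; push_cast; ring
    have hpow : (((N / 2) ^ d : ℕ) : ℝ) * (2 : ℝ) ^ d = ((N ^ d : ℕ) : ℝ) := by
      push_cast; rw [← mul_pow, hhalf]
    have h2 : (2 : ℝ) ^ d ≠ 0 := by positivity
    have hq : (((N / 2) ^ d : ℕ) : ℝ) = ((N ^ d : ℕ) : ℝ) / (2 : ℝ) ^ d := by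
      rw [eq_div_iff h2]; exact hpow
    rw [hq]; ring
  calc tExpect N b p β (prodBad N b univ) ≤ #(tOmega (d := d) N b p) * δ := hratio
    _ ≤ ((2 : ℝ) ^ (b ^ d)) ^ (N ^ d) * δ := mul_le_mul_of_nonneg_right hcard (Real.exp_pos _).le
    _ = ((2 : ℝ) ^ (b ^ d) * Real.exp (-β / 2 ^ d)) ^ (N ^ d) := by rw [hδ', mul_pow]

/-- **The chessboard estimate with the explicit constant**: for `N = 2^(n+1)`, `d ≥ 2`, `b ≥ 2`, `β ≥ 0`
and every set `S` of cells of the torus `(ℤ/Nbℤ)^d` with frozen alternating image spins, the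
probability that all cells of `S` are bad is at most `ε_β^{#S}`, `ε_β = 2^{b^d} e^{-β/2^d}`.
[cite: FriedliVelenik2017, Theorem 10.11] -/
theorem tExpect_prodBad_le_eps_pow {n : ℕ} (hd : 2 ≤ d) (hNn : N = 2 ^ (n + 1)) (hb : 2 ≤ b) (p : ℤˣ) {β : ℝ}
    (hβ : 0 ≤ β) (S : Finset (BlockIdx d N)) :
    tExpect N b p β (prodBad N b S) ≤ ((2 : ℝ) ^ (b ^ d) * Real.exp (-β / 2 ^ d)) ^ #S :=
  tExpect_prodBad_le_pow hd hNn hb p β (by positivity) (tExpect_prodBad_univ_le hd hNn hb p hβ) S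

/-- The same for cells indexed by lower corners in `ℤ^d` pairwise incongruent mod `N`.
[cite: FriedliVelenik2017, Theorem 10.11] -/
theorem tExpect_prod_badInd_le_eps_pow {n : ℕ} (hd : 2 ≤ d) (hNn : N = 2 ^ (n + 1)) (hb : 2 ≤ b) (p : ℤˣ) {β : ℝ}
    (hβ : 0 ≤ β) (C : Finset (Site d)) (hC : Set.InjOn (fun c : Site d => fun j => (c j : ZMod N)) C) :
    tExpect N b p β (fun σ => ∏ c ∈ C, badInd N b c σ) ≤ ((2 : ℝ) ^ (b ^ d) * Real.exp (-β / 2 ^ d)) ^ #C :=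
  tExpect_prod_badInd_le_pow hd hNn hb p β (by positivity) (tExpect_prodBad_univ_le hd hNn hb p hβ) C hC

end Dissemination

end Literature.Barriers.CriticalPhenomena.NonGibbs

end
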